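import Literature.Computability.Cryptography.QubitRegister
import Literature.Computability.Cryptography.QuantumCircuit
import Literature.Computability.Cryptography.ClassBQP
import Literature.Computability.Complexity.Classes
import Literature.Computability.Complexity.ProbabilisticClasses
import Literature.Computability.QuantumComplexity.ClassicalClasses
import Literature.Computability.QuantumComplexity.QuantumTuring
import Literature.Computability.QuantumComplexity.BQP
import HarnessLib

/-!
# QuantumAdvantage — problem statement (D-0007: predetermined problem; this file is CREATED BY THE OPERATOR via docs/m5/create_problems.py, never proposed by agents)

The summit statement (no variants, D-0015), assembled by the M5 migration from
`harness21/H21/H21/Statements/QuantumAdvantage/BQP.lean` and fixed by the statement audit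
2026-08-13 (refuter-audit-QuantumAdvantage-0) + ruling D-0015: the summit is the existential
(witness) form `∃ L, L ∈ BQP ∧ L ∉ BPP` — "some language is decided with error ≤ 1/3 by a
poly-time-uniform quantum circuit family and by no probabilistic poly-time TM" (D-0013 #12) —
which is what field experts mean by "BQP ≠ BPP" given the theorem `BPP ⊆ BQP`
(Bernstein–Vazirani 1997, §8). The class inequality `BQP ≠ BPP` itself is an ordinary
Literature statement (`Literature/Computability/QuantumComplexity/BQP.lean`), not a sibling here.
-/

-- provenance: harness21/H21/H21/Statements/QuantumAdvantage/BQP.lean @ 576a5e9 (interim HEAD d8f2665); M5 mechanical rewrite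
noncomputable section

namespace Literature.QuantumAdvantage

open _root_.Computability Literature.Computability.Complexity Literature.Computability.Cryptography

/-! ### quantum-advantage.S01: the summit -/

/-- **quantum-advantage.S01** (summit; D-0013 #12, D-0015). "Some language is decided with
error `≤ 1/3` by a poly-time uniform quantum circuit family and by no probabilistic poly-time TM",
i.e. `BQP ⊄ BPP`, over the alphabet `{0,1}`:
* `Literature.Computability.Cryptography.BQP` — languages decided with two-sided error `≤ 1/3` by a
  polynomial-time uniform (`1ⁿ ↦ ⟨Qₙ⟩` in deterministic polynomial time), oracle-free family of
  quantum circuits over the finite universal gate set Clifford+T `{H, S, T, CNOT}`, run on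
  `|x⟩|0…0⟩` and measured on one output wire [Watrous 2009, §IV.1, `BQP = BQP(2/3, 1/3)`;
  Yao 1993]. This circuit-family class equals Bernstein–Vazirani's QTM class
  [Bernstein–Vazirani 1997, §8] by Yao 1993 / Nishimura–Ozawa 2002 (Thm. 5.7), recorded as the
  fact `Literature.Computability.QuantumComplexity.BQPQTM_eq_BQP` (S04), and does not depend on the finite universal
  gate set (Solovay–Kitaev; `BQPOver_eq_BQP`, S26);
* `Literature.CplxCore.BPP = bp P` — Arora–Barak Def. 7.3 (random-string form); Gill's machine form
  is the fact `mem_BPP_iff_gill` (S25).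
Aaronson 2010, §1: "It is now widely conjectured that BPP ≠ BQP"; since `BPP ⊆ BQP`
(Bernstein–Vazirani 1997, §8; fact `BPP_subset_BQP`) the class inequality is equivalent to this
existential form, which is the one parallel to `PneNP` (`∃ L, L ∈ NP ∧ L ∉ P`) and immune to
formalisation artefacts in the direction `BPP ⊆ BQP`. Open.
[cite: Aaronson2010, §1] [cite: BernsteinVazirani1997, §8] [problem: quantum-advantage] -/
def BQPNotSubsetBPP : Prop :=
  ∃ L : Language Bool, L ∈ BQP ∧ L ∉ BPP

end Literature.QuantumAdvantage

/-- The `QuantumAdvantage` problem statement (D-0010; canonical root-level name checked by the gate) := `Literature.QuantumAdvantage.BQPNotSubsetBPP` (statement audit 2026-08-13 + D-0015: existential form). [problem: quantum-advantage] -/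
def QuantumAdvantage : Prop := Literature.QuantumAdvantage.BQPNotSubsetBPP
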